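import Summits.AnomalousDissipation.AnomalousDissipation.Theses.VirtualDissipation
import Summits.AnomalousDissipation.AnomalousDissipation.Theorems.TaylorCertificatesSteadyStatesLoudBoundedStubCompactnessSplit
import HarnessLib

/-!
# Census sketch — typed signatures quoted in `STRATEGY-CENSUS.md` of crux `LambRigidGP` (stmt-AnomalousDissipation-15150)

Strategist `planner-cstrat-stmt-AnomalousDissipation-15150-s1-0`, 2026-08-17.  Definitions only (no obligations, no sorries):
the strengthenings S1/S5, the lattice form S4 (`LowDegreeNoDodgerGP`), and the negation target of §N4/§D4
(`GPDriftStateBelow` — the exact-drift-solution core of the sheet-dodger mechanism, Theorem A of the sibling crux 13038).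
`f_GP` is inlined exactly as in the route file.
-/

set_option linter.dupNamespace false

noncomputable section

namespace Summit.AnomalousDissipation.AnomalousDissipation.Cruxes.LambRigidGP.CensusSketch

open MeasureTheory Filter Topology UnitAddTorus
open scoped InnerProductSpace ENNReal
open Literature.Analysis.FunctionSpaces Literature.Analysis.FluidPDE

/-- The pinned Galloway–Proctor force, verbatim the route file's inline expression. -/
def fGP (x : UnitAddTorus (Fin 3)) : EuclideanSpace ℝ (Fin 3) :=
  (Torus.stokesMode (Pi.single (2 : Fin 3) (1 : ℤ)) (EuclideanSpace.single (0 : Fin 3) (1 : ℝ)) false x +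
    Torus.stokesMode (Pi.single (0 : Fin 3) (1 : ℤ)) (EuclideanSpace.single (1 : Fin 3) (1 : ℝ)) false x +
    Torus.stokesMode (Pi.single (1 : Fin 3) (1 : ℤ)) (EuclideanSpace.single (2 : Fin 3) (1 : ℝ)) false x :
    EuclideanSpace ℝ (Fin 3))

/-- `R` is a residual bound of `u` with respect to the force `f` (dual-enstrophy norm of the steady-Euler residual). -/
def IsResidualBound (f u : UnitAddTorus (Fin 3) → EuclideanSpace ℝ (Fin 3)) (R : ℝ) : Prop :=
  ∀ w : UnitAddTorus (Fin 3) → EuclideanSpace ℝ (Fin 3), Torus.IsSmooth w → Torus.IsDivFree w → Torus.HasZeroMean w →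
    |∫ x, ⟪Torus.convect u u x - f x, w x⟫_ℝ| ≤ R * Real.sqrt (Torus.gradNormSq w)

/-- Admissible competitor: smooth, divergence free, mean zero. -/
def IsAdmissible (u : UnitAddTorus (Fin 3) → EuclideanSpace ℝ (Fin 3)) : Prop :=
  Torus.IsSmooth u ∧ Torus.IsDivFree u ∧ Torus.HasZeroMean u

/-- Lamb rigidity of `f` at level `E` with constants `c, δ₀` (the crux is `∃ E ≥ 2, ∃ c δ₀ > 0, RigidAt fGP E c δ₀`). -/
def RigidAt (f : UnitAddTorus (Fin 3) → EuclideanSpace ℝ (Fin 3)) (E c δ₀ : ℝ) : Prop :=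
  ∀ u, IsAdmissible u → ∫ x, ‖u x‖ ^ 2 ≤ E → ∀ R : ℝ, 0 ≤ R → IsResidualBound f u R → R ≤ δ₀ →
    c ≤ R * Real.sqrt (Torus.gradNormSq u)

/-- A bad sequence of `f` at level `E`: admissible, energy `≤ E`, residual bounds `R_n → 0`, virtual dissipation `→ 0`. -/
def IsBadSeq (f : UnitAddTorus (Fin 3) → EuclideanSpace ℝ (Fin 3)) (E : ℝ)
    (u : ℕ → UnitAddTorus (Fin 3) → EuclideanSpace ℝ (Fin 3)) (R : ℕ → ℝ) : Prop :=
  (∀ n, IsAdmissible (u n) ∧ ∫ x, ‖u n x‖ ^ 2 ≤ E ∧ 0 ≤ R n ∧ IsResidualBound f (u n) (R n)) ∧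
    Tendsto R atTop (𝓝 0) ∧ Tendsto (fun n => R n * Real.sqrt (Torus.gradNormSq (u n))) atTop (𝓝 0)

/-! ## Strengthen -/

/-- **S1** `LambRigidEverywhereGP` — rigidity of `f_GP` at EVERY level.  Expected FALSE (large-drift torus-carrying exact solutions
⇒ sheet dodgers, Theorem A of crux 13038; measured for `f_GP` by kit j023272). -/
def LambRigidEverywhereGP : Prop :=
  ∀ E : ℝ, ∃ c δ₀ : ℝ, 0 < c ∧ 0 < δ₀ ∧ RigidAt fGP E c δ₀

/-- **S5** `BadSeqPrecompactAll` — the microstructure half strengthened to ALL smooth forces and levels: bad sequences are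
`L²`-precompact.  Its `(fGP, 2)` instance is the registered stub `stub_badSeqPrecompactGP` of line `conservative-cut`. -/
def BadSeqPrecompactAll : Prop :=
  ∀ (f : UnitAddTorus (Fin 3) → EuclideanSpace ℝ (Fin 3)) (E : ℝ), Torus.IsSmooth f →
    ∀ u R, IsBadSeq f E u R →
      ∃ (φ : ℕ → ℕ) (v : UnitAddTorus (Fin 3) → EuclideanSpace ℝ (Fin 3)), StrictMono φ ∧ MemLp v 2 volume ∧
        ∫ x, ‖v x‖ ^ 2 ≤ E ∧ Tendsto (fun n => ∫ x, ‖u (φ n) x - v x‖ ^ 2) atTop (𝓝 0)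

/-- **S4** `LowDegreeNoDodgerGP K` — no EXACT dodger of `f_GP` of degree `≤ K` in the closed 2-ball (semialgebraic, decidable per `K`;
by compactness of the finite-dimensional ball equivalent to a positive residual floor `r_K > 0`).  TRUE for `K ≤ 7` (dead-line census,
numerically); the crux is the RATE `r_K ≳ 1/K`, which no `K` sees. -/
def LowDegreeNoDodgerGP (K : ℕ) : Prop :=
  ∀ u, IsAdmissible u → ∫ x, ‖u x‖ ^ 2 ≤ 2 →
    (∀ k : Fin 3 → ℤ, (K : ℝ) ^ 2 < Torus.freqNormSq k → mFourierCoeff (EuclideanSpace.complexify ∘ u) k = 0) →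
    ¬ IsResidualBound fGP u 0

/-! ## Negation target (§N4 / §D4) -/

/-- **`GPDriftStateBelow E`** — an EXACT smooth steady Euler flow of `f_GP` WITH DRIFT (non-zero mean) and total energy `≤ E`:
the analytic core of the sheet-dodger enemy (Theorem A needs in addition an invariant partition by `C²` stream surfaces with a
balanced signing — e.g. a smooth first integral of the flow; omitted here).  `GPDriftStateBelow 2` with tori refutes the crux on paper;
kit j023272 locates the smallest such `E` along nine drift directions. -/
def GPDriftStateBelow (E : ℝ) : Prop :=
  ∃ (V : UnitAddTorus (Fin 3) → EuclideanSpace ℝ (Fin 3)) (p : UnitAddTorus (Fin 3) → ℝ),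
    Torus.IsSmooth V ∧ Torus.IsDivFree V ∧ Torus.IsSmooth p ∧ ¬ Torus.HasZeroMean V ∧
    (∀ x, Torus.convect V V x + Torus.gradient p x = fGP x) ∧ ∫ x, ‖V x‖ ^ 2 ≤ E

/-- Sanity: the crux is literally `∃ E ≥ 2, ∃ c δ₀ > 0, RigidAt fGP E c δ₀` (definitional unfolding). -/
theorem lambRigidGP_iff :
    Summit.AnomalousDissipation.AnomalousDissipation.Theses.VirtualDissipation.LambRigidGP ↔
      ∃ E c δ₀ : ℝ, 2 ≤ E ∧ 0 < c ∧ 0 < δ₀ ∧ RigidAt fGP E c δ₀ := by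
  unfold Summit.AnomalousDissipation.AnomalousDissipation.Theses.VirtualDissipation.LambRigidGP RigidAt IsAdmissible
    IsResidualBound fGP
  constructor
  · rintro ⟨E, c, δ₀, hE, hc, hδ, h⟩
    exact ⟨E, c, δ₀, hE, hc, hδ, fun u hu hEu R hR hres hRδ => h u hu.1 hu.2.1 hu.2.2 hEu R hR hres hRδ⟩
  · rintro ⟨E, c, δ₀, hE, hc, hδ, h⟩
    exact ⟨E, c, δ₀, hE, hc, hδ, fun u hs hd hz hEu R hR hres hRδ => h u ⟨hs, hd, hz⟩ hEu R hR hres hRδ⟩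

/-- S1 is a strengthening: rigidity everywhere gives the crux (take `E := 2`). -/
theorem lambRigidGP_of_everywhere (h : LambRigidEverywhereGP) :
    Summit.AnomalousDissipation.AnomalousDissipation.Theses.VirtualDissipation.LambRigidGP := by
  obtain ⟨c, δ₀, hc, hδ, hr⟩ := h 2
  exact lambRigidGP_iff.2 ⟨2, c, δ₀, le_refl _, hc, hδ, hr⟩

end Summit.AnomalousDissipation.AnomalousDissipation.Cruxes.LambRigidGP.CensusSketch

end
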